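import Mathlib

/-!
# Route EIHFluxBalance — crux `InertialRecession`, line `sublinear-is-free-clean-window-charges`:
# an interval covered by finitely many short intervals is short

Helper file for the crux `stmt-FinalStateConjecture-10166`
(`Summit.FinalStateConjecture.FinalStateConjecture.Theses.EIHFluxBalance.InertialRecession`), registered stub `stub_incrementOracle`
(lead reshape r9/r10) of `Cruxes/InertialRecession/Lines/sublinear_is_free_clean_window_charges.lean`; lead's roadmap §9: a maximal bad
stretch `(τ, τ′)` of a slow pair is covered by the passage intervals `J_m` of the outsiders, each of length `≤ K` (`passage_length_le`), so
`τ′ − τ ≤ |O|·K` (`sub_le_card_mul_of_cover`, by Lebesgue measure).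
-/

noncomputable section

set_option linter.dupNamespace false

open Set MeasureTheory

namespace Summit.FinalStateConjecture.FinalStateConjecture.Theorems.SublinearIsFree.Oracle

/-- A set of reals all of whose pairs of points are within `K` has Lebesgue outer measure `≤ K`. [folklore] -/
theorem volume_le_of_pairwise_le {J : Set ℝ} {K : ℝ} (hJ : ∀ p ∈ J, ∀ q ∈ J, q - p ≤ K) :
    volume J ≤ ENNReal.ofReal K := by
  rcases J.eq_empty_or_nonempty with h | ⟨p₀, hp₀⟩
  · simp [h]
  · have hsub : J ⊆ Icc (p₀ - K) (p₀ + K) := fun q hq ↦ ⟨by linarith [hJ q hq p₀ hp₀], by linarith [hJ p₀ hp₀ q hq]⟩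
    -- sharper: `J ⊆ [inf J, inf J + K]`
    have hbdd : BddBelow J := ⟨p₀ - K, fun q hq ↦ (hsub hq).1⟩
    have hsub' : J ⊆ Icc (sInf J) (sInf J + K) := fun q hq ↦
      ⟨csInf_le hbdd hq, by
        have : ∀ p ∈ J, q - K ≤ p := fun p hp ↦ by linarith [hJ p hp q hq]
        linarith [le_csInf ⟨p₀, hp₀⟩ this]⟩
    calc volume J ≤ volume (Icc (sInf J) (sInf J + K)) := measure_mono hsub'
      _ = ENNReal.ofReal K := by rw [Real.volume_Icc]; ring_nf

/-- **AN INTERVAL COVERED BY FINITELY MANY `K`-SHORT SETS IS SHORT**: if `(τ, τ′) ⊆ ⋃_{m ∈ O} J m` and every `J m` has all pairs of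
points within `K ≥ 0`, then `τ′ − τ ≤ |O|·K`. [folklore] -/
theorem sub_le_card_mul_of_cover {ι : Type*} (O : Finset ι) (J : ι → Set ℝ) {τ τ' K : ℝ} (hK : 0 ≤ K)
    (hJ : ∀ m ∈ O, ∀ p ∈ J m, ∀ q ∈ J m, q - p ≤ K) (hcover : Ioo τ τ' ⊆ ⋃ m ∈ O, J m) :
    τ' - τ ≤ O.card * K := by
  rcases le_or_gt τ' τ with h | h
  · have : (0 : ℝ) ≤ O.card * K := by positivity
    linarith
  have h1 : volume (Ioo τ τ') ≤ ∑ m ∈ O, volume (J m) :=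
    (measure_mono hcover).trans (measure_biUnion_finset_le O J)
  have h2 : ∑ m ∈ O, volume (J m) ≤ ∑ m ∈ O, ENNReal.ofReal K :=
    Finset.sum_le_sum fun m hm ↦ volume_le_of_pairwise_le (hJ m hm)
  rw [Finset.sum_const, nsmul_eq_mul, Real.volume_Ioo] at *
  have h3 : ENNReal.ofReal (τ' - τ) ≤ (O.card : ENNReal) * ENNReal.ofReal K := h1.trans h2
  have h4 : (O.card : ENNReal) * ENNReal.ofReal K = ENNReal.ofReal (O.card * K) := by
    rw [ENNReal.ofReal_mul (by positivity), ENNReal.ofReal_natCast]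
  rw [h4] at h3
  exact (ENNReal.ofReal_le_ofReal_iff (by positivity)).mp h3

/-- Registered helper form of `sub_le_card_mul_of_cover` for index type `Fin N` (carrier of this file). [folklore] -/
theorem oracle_sub_le_card_mul_of_cover : ∀ (N : ℕ) (O : Finset (Fin N)) (J : Fin N → Set ℝ) (τ τ' K : ℝ), 0 ≤ K →
    (∀ m ∈ O, ∀ p ∈ J m, ∀ q ∈ J m, q - p ≤ K) → Set.Ioo τ τ' ⊆ (⋃ m ∈ O, J m) → τ' - τ ≤ O.card * K :=
  fun _ O J _ _ _ hK hJ hcover ↦ sub_le_card_mul_of_cover O J hK hJ hcover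

end Summit.FinalStateConjecture.FinalStateConjecture.Theorems.SublinearIsFree.Oracle

end
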